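import Literature.AlgebraicGeometry.Frobenioids.Thm49Assembly
import HarnessLib

/-!
# [FrdI] §4, the two standing reductions of the proofs of Thm. 4.9 / Cor. 4.11: "WLOG isotropic" (Thm. 3.4 (i),
# Rmk. 4.5.1) and "WLOG perfect" (Thm. 3.4 (iii), Prop. 3.2 (iii), Prop. 5.5 (iii)) — the SETTING at the
# perfections of the isotropifications, built from `C`-level data (reusable pieces of `Thm49Assembly.lean`)

Mochizuki, *The geometry of Frobenioids I: the general theory*, Kyushu J. Math. **62** (2008) 293–400,
§4, proof of Thm. 4.9 p. 89 ll. 3–5, 38–41; proof of Cor. 4.11 p. 92 ("we may assume without loss of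
generality that `C₁`, `C₂` are of isotropic type (cf. Remark 4.5.1)") [cite: MochizukiFrdI2008, Thm. 4.9 p.89].

PROOF-ONLY file (seat abc-iut-w4-d109): the construction buried inside `FrdI.T49.thm49_ofFunctor_of_isOfFSMType`,
exposed BY NAME for the Cor. 4.11 (ii)/(iii)/(iv) assemblers (seats abc-iut-L1-d6 / abc-iut-L1-t14, whose
Setting-level closers `cor411ii_of_congr_istr_pf`, `cor411iii_inst_of_setting`, … take exactly these data as
hypotheses). For Frobenioids `C_i → F_{Φ_i}` of standard type with perf-factorial `Φ_i` over bases of FSM-type,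
`C₁` not of group-like type, and an equivalence `Ψ : C₁ ⥲ C₂`:

* `isFrobeniusCompatible_congrIstr` — Thm. 3.4 (iii) for the restriction `Ψ^istr : C₁^istr ⥲ C₂^istr`
  (`Equivalence.congrFullSubcategory`): it carries arrows of Frobenius type to arrows of Frobenius type of the
  same degree, so `(Ψ^istr)^pf` is defined;
* `isPreStep_inverse_congrIstr` — Thm. 3.4 (ii) for `(Ψ^istr)⁻¹`: pre-steps;
* `isFrobenioid_istr_perfection` — Prop. 3.2 (iii): `(C^istr)^pf` is a Frobenioid (`Perfection.isFrobenioid`);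
* `setting_istr_perfection` — **the `FrdI.T42.Setting` at `((C₁^istr)^pf, (C₂^istr)^pf, (Ψ^istr)^pf)`**
  (`FrdI.T42.setting_perfection`, seat abc-iut-w4-d090);
* `isNonDilatingOn_istr_perfection` — `(Φ^pf)` is non-dilating on the base (standard type (e) + Prop. 3.2);
* `isRational_istr_perfection` — every object of `(C^istr)^pf` is rational at THE birationalization / support,
  when `C` is of rational type (Rmk. 4.5.1 `isRational_istr_of` + Prop. 5.5 (iii) `isRational_perfection_of`).

No new definitions; no statement of the paper is strengthened; nothing here bears on [IUTchIII] Cor. 3.12.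
-/

namespace Literature.AlgebraicGeometry.Frobenioids

namespace FrdI.T49

open CategoryTheory Opposite PreFrobenioidData

universe w v v' u u'

variable {D₁ : Type u} [Category.{v} D₁] {Φ₁ : D₁ᵒᵖ ⥤ CommMonCat.{w}} {C₁ : Type u'} [Category.{v'} C₁]
  {D₂ : Type u} [Category.{v} D₂] {Φ₂ : D₂ᵒᵖ ⥤ CommMonCat.{w}} {C₂ : Type u'} [Category.{v'} C₂]
  {F₁ : C₁ ⥤ ElemFrobenioid Φ₁} {F₂ : C₂ ⥤ ElemFrobenioid Φ₂}

/-- A Frobenioid not of group-like type has a non-group-like object. [cite: MochizukiFrdI2008, Def. 1.2 (iv) p.23] -/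
theorem exists_not_isGroupLikeObj (hng : ¬ (ofFunctor Φ₁ F₁).IsOfGroupLikeType) :
    ∃ A : C₁, ¬ PreFrobenioid.IsGroupLikeObj F₁ A := by
  by_contra h
  exact hng ⟨fun A => (ofFunctor_isGroupLikeObj F₁ A).2 (not_exists_not.mp h A)⟩

/-- **Thm. 3.4 (iii) for `Ψ^istr`**: for Frobenioids of standard type over bases of FSM-type, `C₁` not of
group-like type, the restriction `Ψ^istr : C₁^istr ⥲ C₂^istr` of an equivalence `Ψ` carries arrows of Frobenius
type to arrows of Frobenius type of the same Frobenius degree (through the non-group-like hulls `N^istr`,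
`(Ψ N)^istr`). [cite: MochizukiFrdI2008, Thm. 3.4 (iii) p.62] -/
theorem isFrobeniusCompatible_congrIstr (hF₁ : PreFrobenioid.IsFrobenioid F₁)
    (hF₂ : PreFrobenioid.IsFrobenioid F₂) (hD₁ : IsOfFSMType D₁) (hD₂ : IsOfFSMType D₂)
    (hs₁ : (ofFunctor Φ₁ F₁).IsOfStandardType) (hs₂ : (ofFunctor Φ₂ F₂).IsOfStandardType)
    (hng : ¬ (ofFunctor Φ₁ F₁).IsOfGroupLikeType) (Ψ : C₁ ≌ C₂)
    [(PreFrobenioid.isotropicObjects F₂).IsClosedUnderIsomorphisms] :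
    PreFrobenioid.IsFrobeniusCompatible (PreFrobenioid.istrFunctor F₁) (PreFrobenioid.istrFunctor F₂)
      (Ψ.congrFullSubcategory (FrdI.isotropicObjects_inverseImage hF₁ hs₁.quasiIsotropic
        hs₂.quasiIsotropic Ψ)).functor := by
  obtain ⟨N₁, hN₁⟩ := exists_not_isGroupLikeObj hng
  have hN₂ : ¬ PreFrobenioid.IsGroupLikeObj F₂ (Ψ.functor.obj N₁) := fun h =>
    hN₁ (FrdI.isGroupLikeObj_of_isBaseIso' hF₁.isPreFrobenioid (Ψ.unitIso.app N₁).hom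
      (PreFrobenioid.isBaseIso_of_isIso F₁ _)
      (FrdI.isGroupLikeObj_map_of_quasiIsotropic_of_isOfFSMType hF₂ hF₁ hs₂.quasiIsotropic hs₁.quasiIsotropic
        hD₂ Ψ.symm h))
  exact FrdI.T42.isFrobeniusCompatible_of_isOfFSMType _ (PreFrobenioid.isFrobenioid_istr hF₁)
    (PreFrobenioid.isFrobenioid_istr hF₂) (PreFrobenioid.isOfStandardType_istr hF₁ hs₁).quasiIsotropic
    (PreFrobenioid.isOfStandardType_istr hF₂ hs₂).quasiIsotropic (FrdI.isNonDilatingOn_of_ofFunctor hs₁.nonDilating)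
    (FrdI.isNonDilatingOn_of_ofFunctor hs₂.nonDilating) hD₁ hD₂ (not_isGroupLikeObj_hullIstr hF₁ hN₁)
    (not_isGroupLikeObj_hullIstr hF₂ hN₂)

/-- **Thm. 3.4 (ii) for `(Ψ^istr)⁻¹`**: pre-steps are carried to pre-steps (quasi-isotropic Frobenioids over
bases of FSM-type). [cite: MochizukiFrdI2008, Thm. 3.4 (ii) p.62] -/
theorem isPreStep_inverse_congrIstr (hF₁ : PreFrobenioid.IsFrobenioid F₁) (hF₂ : PreFrobenioid.IsFrobenioid F₂)
    (hD₁ : IsOfFSMType D₁) (hs₁ : (ofFunctor Φ₁ F₁).IsOfStandardType) (hs₂ : (ofFunctor Φ₂ F₂).IsOfStandardType)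
    (Ψ : C₁ ≌ C₂) [(PreFrobenioid.isotropicObjects F₂).IsClosedUnderIsomorphisms]
    ⦃X Y : PreFrobenioid.Istr F₂⦄ (g : X ⟶ Y) (hg : PreFrobenioid.IsPreStep (PreFrobenioid.istrFunctor F₂) g) :
    PreFrobenioid.IsPreStep (PreFrobenioid.istrFunctor F₁)
      ((Ψ.congrFullSubcategory (FrdI.isotropicObjects_inverseImage hF₁ hs₁.quasiIsotropic
        hs₂.quasiIsotropic Ψ)).inverse.map g) :=
  FrdI.isPreStep_map_of_quasiIsotropic_of_isOfFSMType (PreFrobenioid.isFrobenioid_istr hF₂)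
    (PreFrobenioid.isFrobenioid_istr hF₁) (PreFrobenioid.isOfStandardType_istr hF₂ hs₂).quasiIsotropic
    (PreFrobenioid.isOfStandardType_istr hF₁ hs₁).quasiIsotropic hD₁
    (Ψ.congrFullSubcategory (FrdI.isotropicObjects_inverseImage hF₁ hs₁.quasiIsotropic
      hs₂.quasiIsotropic Ψ)).symm hg

/-- **Prop. 3.2 (iii) for `C^istr`**: `(C^istr)^pf` is a Frobenioid (`C^istr` is of isotropic, hence
Frobenius-isotropic, type). [cite: MochizukiFrdI2008, Prop. 3.2 (iii) p.59] -/
theorem isFrobenioid_istr_perfection (hF₁ : PreFrobenioid.IsFrobenioid F₁) :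
    PreFrobenioid.IsFrobenioid
      (PreFrobenioid.Perfection.ops (PreFrobenioid.isFrobenioid_istr hF₁)).toFunctor :=
  PreFrobenioid.Perfection.isFrobenioid _
    (FrdI.T42.isFrobeniusIsotropic_of_isOfIsotropicType (PreFrobenioid.isFrobenioid_istr hF₁)
      PreFrobenioid.isOfIsotropicType_istr)

/-- **The setting of the proofs of Thm. 4.9 / Cor. 4.11 at the perfections of the isotropifications**
`((C₁^istr)^pf, (C₂^istr)^pf, (Ψ^istr)^pf)`, from `C`-level data: Frobenioids of standard type with
perf-factorial `Φ_i` over bases of FSM-type, `C₁` not of group-like type.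
[cite: MochizukiFrdI2008, Thm. 4.9 p.89] -/
theorem setting_istr_perfection (hF₁ : PreFrobenioid.IsFrobenioid F₁) (hF₂ : PreFrobenioid.IsFrobenioid F₂)
    (hD₁ : IsOfFSMType D₁) (hD₂ : IsOfFSMType D₂)
    (hpf₁ : Objectwise (fun M _ => IsPerfFactorial M) Φ₁) (hpf₂ : Objectwise (fun M _ => IsPerfFactorial M) Φ₂)
    (hs₁ : (ofFunctor Φ₁ F₁).IsOfStandardType) (hs₂ : (ofFunctor Φ₂ F₂).IsOfStandardType)
    (hng : ¬ (ofFunctor Φ₁ F₁).IsOfGroupLikeType) (Ψ : C₁ ≌ C₂)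
    [(PreFrobenioid.isotropicObjects F₂).IsClosedUnderIsomorphisms] :
    haveI := PreFrobenioid.Perfection.map_isEquivalence (hF₁ := PreFrobenioid.isFrobenioid_istr hF₁)
      (hF₂ := PreFrobenioid.isFrobenioid_istr hF₂) _ (isFrobeniusCompatible_congrIstr hF₁ hF₂ hD₁ hD₂ hs₁ hs₂ hng Ψ)
    FrdI.T42.Setting (PreFrobenioid.Perfection.ops (PreFrobenioid.isFrobenioid_istr hF₁)).toFunctor
      (PreFrobenioid.Perfection.ops (PreFrobenioid.isFrobenioid_istr hF₂)).toFunctor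
      (PreFrobenioid.Perfection.map (hF₁ := PreFrobenioid.isFrobenioid_istr hF₁)
        (hF₂ := PreFrobenioid.isFrobenioid_istr hF₂)
        (isFrobeniusCompatible_congrIstr hF₁ hF₂ hD₁ hD₂ hs₁ hs₂ hng Ψ)).asEquivalence := by
  obtain ⟨N₁, hN₁⟩ := exists_not_isGroupLikeObj hng
  have hN₂ : ¬ PreFrobenioid.IsGroupLikeObj F₂ (Ψ.functor.obj N₁) := fun h =>
    hN₁ (FrdI.isGroupLikeObj_of_isBaseIso' hF₁.isPreFrobenioid (Ψ.unitIso.app N₁).hom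
      (PreFrobenioid.isBaseIso_of_isIso F₁ _)
      (FrdI.isGroupLikeObj_map_of_quasiIsotropic_of_isOfFSMType hF₂ hF₁ hs₂.quasiIsotropic hs₁.quasiIsotropic
        hD₂ Ψ.symm h))
  exact FrdI.T42.setting_perfection _ (PreFrobenioid.isFrobenioid_istr hF₁) (PreFrobenioid.isFrobenioid_istr hF₂)
    (isFrobenioid_istr_perfection hF₁) (isFrobenioid_istr_perfection hF₂) PreFrobenioid.isOfIsotropicType_istr
    PreFrobenioid.isOfIsotropicType_istr hpf₁ hpf₂ (PreFrobenioid.isOfStandardType_istr hF₁ hs₁).nonDilating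
    (PreFrobenioid.isOfStandardType_istr hF₂ hs₂).nonDilating hD₁ hD₂ (not_isGroupLikeObj_hullIstr hF₁ hN₁)
    (not_isGroupLikeObj_hullIstr hF₂ hN₂) _

/-- `(Φ^pf)` is non-dilating on the base of `(C^istr)^pf` when `C` is of standard type (Def. 3.1 (i)(e) for
`C^istr`, Rmk. 4.5.1, then Prop. 3.2 for the perfection). [cite: MochizukiFrdI2008, Prop. 3.2 (iii) p.59] -/
theorem isNonDilatingOn_istr_perfection (hF₂ : PreFrobenioid.IsFrobenioid F₂)
    (hs₂ : (ofFunctor Φ₂ F₂).IsOfStandardType) :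
    IsNonDilatingOn (PreFrobenioid.Perfection.ops (PreFrobenioid.isFrobenioid_istr hF₂)).monFunctor :=
  FrdI.isNonDilatingOn_of_ofFunctor
    (F := (PreFrobenioid.Perfection.ops (PreFrobenioid.isFrobenioid_istr hF₂)).toFunctor)
    (PreFrobenioid.Perfection.isNonDilatingOn_ops _ (PreFrobenioid.isOfStandardType_istr hF₂ hs₂).nonDilating)

/-- **Every object of `(C^istr)^pf` is rational** at THE birationalization and THE support predicate, when `C`
is of rational type (Rmk. 4.5.1 `isRational_istr_of`, then Prop. 5.5 (iii) `Perfection.isRational_perfection_of`).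
[cite: MochizukiFrdI2008, Prop. 5.5 (iii) p.104] -/
theorem isRational_istr_perfection (hF₁ : PreFrobenioid.IsFrobenioid F₁)
    {hPf₁ : PreFrobenioid.IsFrobenioid (PreFrobenioid.Perfection.ops (PreFrobenioid.isFrobenioid_istr hF₁)).toFunctor}
    {hsqP : PreFrobenioid.HasBiratSquares (PreFrobenioid.Perfection.ops (PreFrobenioid.isFrobenioid_istr hF₁)).toFunctor}
    (hrat₁ : ∀ A : C₁, PreFrobenioidData.IsRational
      (PreFrobenioid.biratData hF₁ (PreFrobenioid.hasBiratSquares_of_isFrobenioid hF₁))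
      (S := ofFunctor Φ₁ F₁) (fun a 𝔭 => PrimarySupp a 𝔭) A)
    (X : PreFrobenioid.Perfection (PreFrobenioid.isFrobenioid_istr hF₁)) :
    PreFrobenioidData.IsRational (PreFrobenioid.biratData hPf₁ hsqP)
      (S := ofFunctor _ (PreFrobenioid.Perfection.ops (PreFrobenioid.isFrobenioid_istr hF₁)).toFunctor)
      (fun a 𝔭 => PrimarySupp a 𝔭) X :=
  PreFrobenioid.Perfection.isRational_perfection_of _ hPf₁
    (hsq := PreFrobenioid.hasBiratSquares_of_isFrobenioid (PreFrobenioid.isFrobenioid_istr hF₁))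
    (fun A => PreFrobenioid.isRational_istr_of hF₁ hrat₁ A) X

end FrdI.T49

end Literature.AlgebraicGeometry.Frobenioids
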